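import Mathlib.Analysis.InnerProductSpace.Positive
import Mathlib.Analysis.Matrix.Order
import Mathlib.LinearAlgebra.Matrix.PosDef
import Mathlib.LinearAlgebra.Matrix.Symmetric
import Mathlib.LinearAlgebra.Matrix.Trace

/-!
# Crux `DiagonalMirrorRPR` (stmt-QuantumFields-10604), crux idea `sign-twisted-diagonal-trace`: the abstract
# sign-twisted trace bound (finite-dimensional form), PROVED

Helper for the crux `DiagonalMirrorRPR` of `YangMills` (routes `PencilRigidity`, `MirrorModularBoosts`,
`IsotropyFromPowerCounting`; item stmt-QuantumFields-10604), attached `--supports`; it closes nothing by itself.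

The crux-idea card `Cruxes/DiagonalMirrorRPR/Ideas/sign-twisted-diagonal-trace.md` (crux-ideate seat 1, critic verdict
idea-crit-9 g12 #108 = PASS-WITH-PRICE) slices the scheme's own odd torus along `u = x₀ + x₁`: with `K` the diagonal
one-step transfer operator and `W` the unit translation along the slice, `A := K W^{(N+1)/2}` is self-adjoint,
`S = A² = K K^*`, `U := sgn A` (so `|A| = A U ≥ 0`), and for a reflected pair of half-observables with Gram operator
`X ≥ 0` and `M` odd free diagonal steps across the far side the pairing is the sign-twisted trace
`Tr (X A^M) = Tr (X |A|^M P₊) − Tr (X |A|^M P₋)`, `P± = (1 ± U)/2`.  The two ELEMENTARY operator facts the line rests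
on were typed by the seat as `def TwistedTraceBound : Prop` and `def EvenPartNonneg : Prop` in `Sketch-seat1.lean`
(sha256 `5bf5d1dd…`); this file (same namespace) proves them — the theorem TYPES below are the bodies of those two
`def`s VERBATIM:

* `evenPartNonneg` — the `U`-even part is a positive form: `Tr (X |A|^M (1 + U)) ≥ 0` for `X ≥ 0` (the SOURCE OF THE
  SIGN);
* `twistedTraceBound` — if moreover `|A| ≤ μ` on the `U`-odd sector (`(μ − |A|)(1 − U) ≥ 0`), `M` is odd and
  `2t ≤ M`, then additionally `Tr (X A^M) ≥ −μ^{M−2t} · Tr (X A^{2t})`.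

(The seat's by-name `def … : Prop` declarations with `_holds` witnesses are one-line consequences and are added to this
file append-only as reviewed new definitions, D-0009.)

Proof (finite-dimensional, [folklore]): `B := A U ≥ 0` commutes with `U`; `E := 1 + U ≥ 0` (`E² = 2E`) and
`F := 1 − U` commute with `B`, and `E − F = 2U`, `E + F = 2`; `A^M = B^M U` (`M` odd), `A^{2t} = B^{2t}`.
Hence `2 Tr (X A^M) + 2 μ^k Tr (X A^{2t}) = Tr (X B^M E) + μ^k Tr (X B^{2t} E) + Tr (X B^{2t} (μ^k − B^k) F)`
(`k = M − 2t`), and all three terms are traces of `X ≥ 0` against positive semidefinite matrices: products of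
COMMUTING positive semidefinite matrices are positive semidefinite (Mathlib `Commute.mul_nonneg` in the matrix
C⋆-order; Horn–Johnson 7.2.P21 (a)), and `B^j (μ^k − B^k) F ≥ 0` by induction on `k` from
`μ^{k+1} − B^{k+1} = μ (μ^k − B^k) + B^k (μ − B)` and the hypothesis `(μ − B) F ≥ 0`.  (The hypothesis `A.IsSymm`
of both statements is idle: it follows from the others, `A = B U = U B` with `B, U` symmetric and commuting.)  No sorry,
no definition; Mathlib only.

HONEST FRAMING: this de-risks the elementary lever of ONE idea card; it is NOT a registered stub and NOT rung/summit
progress; stmt-QuantumFields-10604 stays OPEN (as typed: misstated, leaf verdict of record); the Yang–Mills mass gap is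
NOT proved here or anywhere in the tree.
-/

set_option autoImplicit false

namespace Summit.QuantumFields.YangMills.Cruxes.DiagonalMirrorRPR.SignTwistedDiagonalTrace

open Matrix

/-! ## Finite-dimensional operator lemmas -/

section Lemmas

open scoped MatrixOrder

variable {d : ℕ}

/-- `Tr (P Q) ≥ 0` for positive semidefinite real `P, Q` (write `Q = Σ v vᵀ`; then `Tr (P Q) = Σ vᵀ P v`). [folklore] -/
theorem trace_mul_nonneg_of_posSemidef {P Q : Matrix (Fin d) (Fin d) ℝ} (hP : P.PosSemidef)
    (hQ : Q.PosSemidef) : 0 ≤ (P * Q).trace := by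
  obtain ⟨m, v, hv⟩ := Matrix.posSemidef_iff_eq_sum_vecMulVec.mp hQ
  rw [hv, Finset.mul_sum, Matrix.trace_sum]
  refine Finset.sum_nonneg fun i _ => ?_
  rw [Matrix.mul_vecMulVec, Matrix.trace_vecMulVec, dotProduct_comm]
  exact hP.dotProduct_mulVec_nonneg (v i)

/-- The product of two COMMUTING positive semidefinite real matrices is positive semidefinite (Mathlib's
`Commute.mul_nonneg` in the C⋆-order on matrices; Horn–Johnson 7.2.P21 (a)). [folklore] -/
theorem posSemidef_mul_of_commute {P Q : Matrix (Fin d) (Fin d) ℝ} (hP : P.PosSemidef) (hQ : Q.PosSemidef)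
    (h : Commute P Q) : (P * Q).PosSemidef :=
  Matrix.nonneg_iff_posSemidef.mp
    (Commute.mul_nonneg (Matrix.nonneg_iff_posSemidef.mpr hP) (Matrix.nonneg_iff_posSemidef.mpr hQ) h)

/-- A symmetric real matrix `E` with `E² = 2E` (twice an orthogonal projection) is positive semidefinite:
`E = ½ Eᵀ E`. [folklore] -/
theorem posSemidef_of_isSymm_of_mul_self {E : Matrix (Fin d) (Fin d) ℝ} (hE : E.IsSymm)
    (hEE : E * E = (2 : ℝ) • E) : E.PosSemidef := by
  have h : ((1 / 2 : ℝ) • (Eᴴ * E)).PosSemidef :=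
    (Matrix.posSemidef_conjTranspose_mul_self E).smul (by norm_num)
  have hH : Eᴴ = E := by rw [Matrix.conjTranspose_eq_transpose_of_trivial, hE.eq]
  rwa [hH, hEE, smul_smul, show (1 / 2 : ℝ) * 2 = 1 by norm_num, one_smul] at h

/-- For an involution `U` (`U² = 1`, symmetric): `1 + U ≥ 0`. [folklore] -/
theorem posSemidef_one_add {U : Matrix (Fin d) (Fin d) ℝ} (hU : U.IsSymm) (hUU : U * U = 1) :
    ((1 : Matrix (Fin d) (Fin d) ℝ) + U).PosSemidef := by
  refine posSemidef_of_isSymm_of_mul_self (Matrix.isSymm_one.add hU) ?_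
  rw [add_mul, mul_add, mul_add, one_mul, mul_one, one_mul, hUU, two_smul]
  abel

/-- The key monotonicity step on the `U`-odd sector: if `B ≥ 0` commutes with `F`, `(μ − B) F ≥ 0` and `0 ≤ μ`,
then `B^j (μ^k − B^k) F ≥ 0` for all `j, k` (induction on `k`:
`μ^{k+1} − B^{k+1} = μ (μ^k − B^k) + B^k (μ − B)`). [folklore] -/
theorem posSemidef_pow_mul_sub_pow_mul {B F : Matrix (Fin d) (Fin d) ℝ} {μ : ℝ} (hB : B.PosSemidef)
    (hBF : Commute B F) (hμ : 0 ≤ μ)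
    (hP : ((μ • (1 : Matrix (Fin d) (Fin d) ℝ) - B) * F).PosSemidef) (k j : ℕ) :
    (B ^ j * ((μ ^ k • (1 : Matrix (Fin d) (Fin d) ℝ) - B ^ k) * F)).PosSemidef := by
  induction k generalizing j with
  | zero => simpa using Matrix.PosSemidef.zero
  | succ k ih =>
    have hsplit : μ ^ (k + 1) • (1 : Matrix (Fin d) (Fin d) ℝ) - B ^ (k + 1) =
        μ • (μ ^ k • (1 : Matrix (Fin d) (Fin d) ℝ) - B ^ k) + B ^ k * (μ • (1 : Matrix (Fin d) (Fin d) ℝ) - B) := by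
      rw [smul_sub, smul_smul, ← pow_succ', Matrix.mul_sub, Matrix.mul_smul, Matrix.mul_one, ← pow_succ]
      exact (sub_add_sub_cancel _ _ _).symm
    have hcomm : Commute (B ^ (j + k)) ((μ • (1 : Matrix (Fin d) (Fin d) ℝ) - B) * F) :=
      ((((Commute.one_right B).smul_right μ).sub_right (Commute.refl B)).mul_right hBF).pow_left _
    have hcalc : B ^ j * ((μ ^ (k + 1) • (1 : Matrix (Fin d) (Fin d) ℝ) - B ^ (k + 1)) * F) =
        μ • (B ^ j * ((μ ^ k • (1 : Matrix (Fin d) (Fin d) ℝ) - B ^ k) * F)) +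
          B ^ (j + k) * ((μ • (1 : Matrix (Fin d) (Fin d) ℝ) - B) * F) := by
      rw [hsplit, add_mul, smul_mul_assoc, Matrix.mul_add, Matrix.mul_smul, Matrix.mul_assoc, pow_add,
        Matrix.mul_assoc]
    rw [hcalc]
    exact ((ih j).smul hμ).add (posSemidef_mul_of_commute (hB.pow _) hP hcomm)

end Lemmas

/-! ## The two statements of the seat, proved -/

section Proofs

variable {d : ℕ}

/-- Common bookkeeping: with `B := A U`, `B U = A` and `U B = A`, so `B` commutes with `U`. -/
private theorem commute_mul_of_involution {A U : Matrix (Fin d) (Fin d) ℝ} (hUU : U * U = 1)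
    (hAU : A * U = U * A) : A * U * U = A ∧ Commute (A * U) U := by
  have h1 : A * U * U = A := by rw [Matrix.mul_assoc, hUU, Matrix.mul_one]
  refine ⟨h1, ?_⟩
  show A * U * U = U * (A * U)
  rw [h1, ← Matrix.mul_assoc, ← hAU, h1]

/-- The `U`-even part is nonnegative: `Tr (X (A U)^M (1 + U)) ≥ 0` — `(A U)^M (1 + U)` is a product of commuting
positive semidefinite matrices and `X ≥ 0`. [folklore] -/
theorem trace_even_part_nonneg (A U X : Matrix (Fin d) (Fin d) ℝ) (M : ℕ) (hU : U.IsSymm) (hUU : U * U = 1)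
    (hAU : A * U = U * A) (hB : (A * U).PosSemidef) (hX : X.PosSemidef) :
    0 ≤ (X * (A * U) ^ M * ((1 : Matrix (Fin d) (Fin d) ℝ) + U)).trace := by
  obtain ⟨-, hBU⟩ := commute_mul_of_involution hUU hAU
  have hBE : Commute ((A * U) ^ M) ((1 : Matrix (Fin d) (Fin d) ℝ) + U) :=
    ((Commute.one_right _).add_right hBU).pow_left M
  rw [Matrix.mul_assoc]
  exact trace_mul_nonneg_of_posSemidef hX
    (posSemidef_mul_of_commute (hB.pow M) (posSemidef_one_add hU hUU) hBE)

/-- **Seat-1's `EvenPartNonneg`, proved** (the type is the body of that `def … : Prop`, verbatim): the `U`-even part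
alone is a positive form (the SOURCE OF THE SIGN): for `X ≥ 0`, `Tr (X |A|^M P₊) ≥ 0`. [folklore] -/
theorem evenPartNonneg :
    ∀ (d : ℕ) (A U X : Matrix (Fin d) (Fin d) ℝ) (M : ℕ),
      A.IsSymm → U.IsSymm → U * U = 1 → A * U = U * A → (A * U).PosSemidef → X.PosSemidef →
        0 ≤ (X * (A * U) ^ M * ((1 : Matrix (Fin d) (Fin d) ℝ) + U)).trace := by
  intro d A U X M _hA hU hUU hAU hB hX
  exact trace_even_part_nonneg A U X M hU hUU hAU hB hX

/-- The odd-sector bound: `Tr (X A^M) ≥ −μ^{M−2t} Tr (X A^{2t})` for `M` odd, `2t ≤ M`, `|A| ≤ μ` on the `U`-odd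
sector. [folklore] -/
theorem trace_twisted_lower_bound (A U X : Matrix (Fin d) (Fin d) ℝ) (μ : ℝ) (M t : ℕ) (hU : U.IsSymm)
    (hUU : U * U = 1) (hAU : A * U = U * A) (hB : (A * U).PosSemidef) (hX : X.PosSemidef) (hμ : 0 ≤ μ)
    (hP : ((μ • (1 : Matrix (Fin d) (Fin d) ℝ) - A * U) * ((1 : Matrix (Fin d) (Fin d) ℝ) - U)).PosSemidef)
    (hM : Odd M) (ht : 2 * t ≤ M) :
    -(μ ^ (M - 2 * t) * (X * A ^ (2 * t)).trace) ≤ (X * A ^ M).trace := by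
  obtain ⟨hBUU, hBU⟩ := commute_mul_of_involution hUU hAU
  -- notation
  set B : Matrix (Fin d) (Fin d) ℝ := A * U with hBdef
  set E : Matrix (Fin d) (Fin d) ℝ := 1 + U with hEdef
  set F : Matrix (Fin d) (Fin d) ℝ := 1 - U with hFdef
  set k : ℕ := M - 2 * t with hkdef
  have hMk : M = 2 * t + k := by omega
  have hBE : Commute B E := (Commute.one_right _).add_right hBU
  have hBF : Commute B F := (Commute.one_right _).sub_right hBU
  -- powers of `A = B U`
  have hA : A = B * U := hBUU.symm
  have hU2 : U ^ 2 = 1 := by rw [pow_two, hUU]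
  have hA2t : A ^ (2 * t) = B ^ (2 * t) := by
    rw [hA, hBU.mul_pow, pow_mul U 2 t, hU2, one_pow, Matrix.mul_one]
  have hAM : A ^ M = B ^ M * U := by
    obtain ⟨m, rfl⟩ := hM
    rw [hA, hBU.mul_pow, pow_succ U, pow_mul U 2 m, hU2, one_pow, Matrix.one_mul]
  -- the three nonnegative terms
  have hT1 : 0 ≤ (X * (B ^ M * E)).trace :=
    trace_mul_nonneg_of_posSemidef hX
      (posSemidef_mul_of_commute (hB.pow M) (posSemidef_one_add hU hUU) (hBE.pow_left M))
  have hT2 : 0 ≤ μ ^ k * (X * (B ^ (2 * t) * E)).trace :=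
    mul_nonneg (pow_nonneg hμ k) (trace_mul_nonneg_of_posSemidef hX
      (posSemidef_mul_of_commute (hB.pow (2 * t)) (posSemidef_one_add hU hUU) (hBE.pow_left (2 * t))))
  have hT3 : 0 ≤ (X * (B ^ (2 * t) * ((μ ^ k • (1 : Matrix (Fin d) (Fin d) ℝ) - B ^ k) * F))).trace :=
    trace_mul_nonneg_of_posSemidef hX (posSemidef_pow_mul_sub_pow_mul hB hBF hμ hP k (2 * t))
  -- linear identities between the traces
  have hEF : E - F = (2 : ℝ) • U := by
    rw [hEdef, hFdef, two_smul]
    abel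
  have hEF' : E + F = (2 : ℝ) • (1 : Matrix (Fin d) (Fin d) ℝ) := by
    rw [hEdef, hFdef, two_smul]
    abel
  have hi1 : (X * (B ^ M * E)).trace - (X * (B ^ M * F)).trace = 2 * (X * A ^ M).trace := by
    rw [← Matrix.trace_sub, ← Matrix.mul_sub, ← Matrix.mul_sub, hEF, Matrix.mul_smul, Matrix.mul_smul,
      Matrix.trace_smul, smul_eq_mul, hAM]
  have hi2 : (X * (B ^ (2 * t) * E)).trace + (X * (B ^ (2 * t) * F)).trace = 2 * (X * A ^ (2 * t)).trace := by
    rw [← Matrix.trace_add, ← Matrix.mul_add, ← Matrix.mul_add, hEF', Matrix.mul_smul, Matrix.mul_smul,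
      Matrix.trace_smul, smul_eq_mul, Matrix.mul_one, hA2t]
  have hi3 : (X * (B ^ (2 * t) * ((μ ^ k • (1 : Matrix (Fin d) (Fin d) ℝ) - B ^ k) * F))).trace =
      μ ^ k * (X * (B ^ (2 * t) * F)).trace - (X * (B ^ M * F)).trace := by
    rw [sub_mul, Matrix.mul_sub, smul_mul_assoc, Matrix.one_mul, Matrix.mul_smul, ← Matrix.mul_assoc (B ^ (2 * t)),
      ← pow_add, ← hMk, Matrix.mul_sub, Matrix.mul_smul, Matrix.trace_sub, Matrix.trace_smul, smul_eq_mul]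
  have hi2' : μ ^ k * (X * (B ^ (2 * t) * E)).trace + μ ^ k * (X * (B ^ (2 * t) * F)).trace =
      2 * (μ ^ k * (X * A ^ (2 * t)).trace) := by
    rw [← mul_add, hi2]
    ring
  linarith [hT1, hT2, hT3, hi1, hi2', hi3]

/-- **Seat-1's `TwistedTraceBound`, proved** (the type is the body of that `def … : Prop`, verbatim): FIRST LEMMA
(abstract sign-twisted trace bound, matrix form) — `Tr (X |A|^M (1 + U)) ≥ 0` and, if `|A| ≤ μ` on the `U`-odd sector,
`M` odd, `2t ≤ M`, then `Tr (X A^M) ≥ −μ^{M−2t} · Tr (X A^{2t})`. [folklore] -/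
theorem twistedTraceBound :
    ∀ (d : ℕ) (A U X : Matrix (Fin d) (Fin d) ℝ) (μ : ℝ) (M t : ℕ),
      A.IsSymm → U.IsSymm → U * U = 1 → A * U = U * A → (A * U).PosSemidef → X.PosSemidef → 0 ≤ μ →
      ((μ • (1 : Matrix (Fin d) (Fin d) ℝ) - A * U) * ((1 : Matrix (Fin d) (Fin d) ℝ) - U)).PosSemidef →
      Odd M → 2 * t ≤ M →
        0 ≤ (X * (A * U) ^ M * ((1 : Matrix (Fin d) (Fin d) ℝ) + U)).trace ∧
        -(μ ^ (M - 2 * t) * (X * A ^ (2 * t)).trace) ≤ (X * A ^ M).trace := by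
  intro d A U X μ M t _hA hU hUU hAU hB hX hμ hP hM ht
  exact ⟨trace_even_part_nonneg A U X M hU hUU hAU hB hX,
    trace_twisted_lower_bound A U X μ M t hU hUU hAU hB hX hμ hP hM ht⟩

end Proofs

end Summit.QuantumFields.YangMills.Cruxes.DiagonalMirrorRPR.SignTwistedDiagonalTrace

/-! ## The seat's two statements BY NAME (`def … : Prop` of `Sketch-seat1.lean`, sha256 `5bf5d1dd…`), with their
kernel-closed witnesses

The two `def` BODIES below are the seat's, byte for byte; the docstrings are the seat's minus their trailing `[folklore]`
token (a bracket-tagged parameterless `def … : Prop` under `Summits/…/Theorems` is split out to `Literature/` by the gate's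
relocation step, which these crux-internal statements are not eligible for — they are new, uncited, and proved here). -/

namespace Summit.QuantumFields.YangMills.Cruxes.DiagonalMirrorRPR.SignTwistedDiagonalTrace

/-- FIRST LEMMA (abstract sign-twisted trace bound, matrix form). -/
def TwistedTraceBound : Prop :=
  ∀ (d : ℕ) (A U X : Matrix (Fin d) (Fin d) ℝ) (μ : ℝ) (M t : ℕ),
    A.IsSymm → U.IsSymm → U * U = 1 → A * U = U * A → (A * U).PosSemidef → X.PosSemidef → 0 ≤ μ →
    ((μ • (1 : Matrix (Fin d) (Fin d) ℝ) - A * U) * ((1 : Matrix (Fin d) (Fin d) ℝ) - U)).PosSemidef →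
    Odd M → 2 * t ≤ M →
      0 ≤ (X * (A * U) ^ M * ((1 : Matrix (Fin d) (Fin d) ℝ) + U)).trace ∧
      -(μ ^ (M - 2 * t) * (X * A ^ (2 * t)).trace) ≤ (X * A ^ M).trace

/-- The `U`-even part alone is a positive form (the SOURCE OF THE SIGN): for `X ≥ 0`,
`Tr (X |A|^M P₊) ≥ 0`.  Special case of the first conjunct above, recorded separately. -/
def EvenPartNonneg : Prop :=
  ∀ (d : ℕ) (A U X : Matrix (Fin d) (Fin d) ℝ) (M : ℕ),
    A.IsSymm → U.IsSymm → U * U = 1 → A * U = U * A → (A * U).PosSemidef → X.PosSemidef →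
      0 ≤ (X * (A * U) ^ M * ((1 : Matrix (Fin d) (Fin d) ℝ) + U)).trace

/-- `TwistedTraceBound` holds (witness: `twistedTraceBound` above). -/
theorem TwistedTraceBound_holds : TwistedTraceBound := twistedTraceBound

/-- `EvenPartNonneg` holds (witness: `evenPartNonneg` above). -/
theorem EvenPartNonneg_holds : EvenPartNonneg := evenPartNonneg

end Summit.QuantumFields.YangMills.Cruxes.DiagonalMirrorRPR.SignTwistedDiagonalTrace
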